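import Mathlib
import HarnessLib
import Literature.MathematicalPhysics.StatisticalMechanics.WeightDominatingH73All
import Literature.MathematicalPhysics.StatisticalMechanics.TorusMultiplierKernels

/-!
# Per-mode data of a finite-range decomposition, in the shape consumed by the weight tower
# (Buchholz Thm 2.4 (o),(ii),(v) / Adams–Buchholz–Kotecký–Müller Thm 6.1 ⇒ Lemma 7.3 inputs)

`h73_of_shellBoundsV` (`WeightDominatingH73All.lean`) and `seed_le_of_multipliers`
(`WeightSeedDomination.lean`) take the finite-range decomposition through:
(a) for every mode `κ ≠ 0` a shell index `j' ≤ N` with `InShell L j' κ` and the (v)-shaped bounds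
`ShellBoundsV d n ñ N j' L c C (f κ)` for `f κ j = 𝒞̂_j(κ)`; (b) the symbol inversion
`(Σ_{j=1}^{N+1} cExt N (f κ) j)·â(κ) = 1`; (c) evenness / vanishing at the zero mode of the
coefficients.  This file derives (a)–(c) from hypotheses stated VERBATIM in the shape of the
clauses (o), (ii), (v) of `GradientFRD.TorusFRD` for a kernel family `𝒞 : ℕ → (ℤ/M)^d → ℝ` at fixed
`L, N, M = L^N` and coefficient matrix `A`:

* `shellBoundsV_of_clause_v`, `exists_shell_and_bounds` — (a);
* `sum_cExt_mul_symbR_eq_one` — (b);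
* `cExt_fourierCoeff_neg`, `cExt_fourierCoeff_zero_mode`, `tailMul_neg`, `tailMul_zero_mode` — (c).

Everything is proved; no named fact.

## References
* S. Buchholz, J. Funct. Anal. 275 (2018), Thm 2.4 [Buchholz2016].
* S. Adams, S. Buchholz, R. Kotecký, S. Müller, arXiv:1910.13564, Thm 6.1, Lemma 7.3
  [AdamsBuchholzKoteckyMuller2019].
-/

noncomputable section

namespace Literature.MathematicalPhysics.StatisticalMechanics.GradientFRD

open Finset
open Literature.MathematicalPhysics.StatisticalMechanics.GradientRG (tailMul)

variable {d M : ℕ} [NeZero M]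

/-- **(a), bounds**: the (v) clause of `TorusFRD` at a mode `κ ≠ 0` in the shell `j'` IS
`ShellBoundsV … j' … (j ↦ 𝒞̂_j(κ))` (the `s`-derivative bounds of (v) are simply dropped).
[cite: Buchholz2016, Thm 2.4 (v)] -/
theorem shellBoundsV_of_clause_v {L N n ñ : ℕ} {c C : ℝ} {𝒞 : ℕ → (Fin d → ZMod M) → ℝ}
    (hv : ∀ k, 1 ≤ k → k ≤ N + 1 → ∀ j : ℕ, ∀ κ : Fin d → ZMod M, κ ≠ 0 → InShell L j κ →
      (j < k →
        c / (L : ℝ) ^ (2 * (d + ñ) + 1) * (L : ℝ) ^ (2 * j) / (L : ℝ) ^ ((k - j) * (d - 1 + n)) ≤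
            (fourierCoeff (𝒞 k) κ).re ∧
          ‖fourierCoeff (𝒞 k) κ‖ ≤
            C * (L : ℝ) ^ (2 * (d + ñ) + 1) * (L : ℝ) ^ (2 * j) / (L : ℝ) ^ ((k - j) * (d - 1 + n))) ∧
      (k ≤ j →
        c / (L : ℝ) ^ (2 * (d + ñ) + 1) * (L : ℝ) ^ (2 * k) ≤ (fourierCoeff (𝒞 k) κ).re ∧
          ‖fourierCoeff (𝒞 k) κ‖ ≤ C * (L : ℝ) ^ (2 * k)))
    {κ : Fin d → ZMod M} (hκ : κ ≠ 0) {j' : ℕ} (hj : InShell L j' κ) :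
    ShellBoundsV d n ñ N j' (L : ℝ) c C (fun j => fourierCoeff (𝒞 j) κ) :=
  fun k hk1 hkN => hv k hk1 hkN j' κ hκ hj

/-- **(a)**: every mode `κ ≠ 0` lies in a shell `j' ≤ N` (for `M = L^N`, `L ≥ 5`) where the (v)-bounds
hold. [cite: AdamsBuchholzKoteckyMuller2019, Thm 6.1 (6.9)-(6.10)] -/
theorem exists_shell_and_bounds {L N n ñ : ℕ} (hL : 5 ≤ L) (hM : M = L ^ N) {c C : ℝ}
    {𝒞 : ℕ → (Fin d → ZMod M) → ℝ}
    (hv : ∀ k, 1 ≤ k → k ≤ N + 1 → ∀ j : ℕ, ∀ κ : Fin d → ZMod M, κ ≠ 0 → InShell L j κ →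
      (j < k →
        c / (L : ℝ) ^ (2 * (d + ñ) + 1) * (L : ℝ) ^ (2 * j) / (L : ℝ) ^ ((k - j) * (d - 1 + n)) ≤
            (fourierCoeff (𝒞 k) κ).re ∧
          ‖fourierCoeff (𝒞 k) κ‖ ≤
            C * (L : ℝ) ^ (2 * (d + ñ) + 1) * (L : ℝ) ^ (2 * j) / (L : ℝ) ^ ((k - j) * (d - 1 + n))) ∧
      (k ≤ j →
        c / (L : ℝ) ^ (2 * (d + ñ) + 1) * (L : ℝ) ^ (2 * k) ≤ (fourierCoeff (𝒞 k) κ).re ∧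
          ‖fourierCoeff (𝒞 k) κ‖ ≤ C * (L : ℝ) ^ (2 * k)))
    (κ : Fin d → ZMod M) (hκ : κ ≠ 0) :
    ∃ j', j' ≤ N ∧ InShell L j' κ ∧ ShellBoundsV d n ñ N j' (L : ℝ) c C (fun j => fourierCoeff (𝒞 j) κ) := by
  obtain ⟨j', hj⟩ := exists_inShell (by omega : 2 ≤ L) hκ
  exact ⟨j', inShell_le hL hM hκ hj, hj, shellBoundsV_of_clause_v hv hκ hj⟩

/-- **(b)**: clause (ii) (with evenness (o)) in the form `(Σ_{j=1}^{N+1} cExt N (𝒞̂_·(κ)) j)·â(κ) = 1`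
off the zero mode, for symmetric `A`. [cite: AdamsBuchholzKoteckyMuller2019, Thm 6.1 (ii), (6.4)-(6.5)] -/
theorem sum_cExt_mul_symbR_eq_one {N : ℕ} {A : Matrix (Fin d) (Fin d) ℝ} (hA : A.IsSymm)
    {𝒞 : ℕ → (Fin d → ZMod M) → ℝ} (heven : ∀ k ∈ Icc 1 (N + 1), ∀ x, 𝒞 k (-x) = 𝒞 k x)
    (hinv : ∀ φ : (Fin d → ZMod M) → ℝ, ∑ x, φ x = 0 →
      ellOp A (conv (fun x => ∑ k ∈ Icc 1 (N + 1), 𝒞 k x) φ) = φ)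
    {κ : Fin d → ZMod M} (hκ : κ ≠ 0) :
    (∑ j ∈ Icc 1 (N + 1), cExt N (fun j => fourierCoeff (𝒞 j) κ) j) * symbR A κ = 1 := by
  have h := sum_re_fourierCoeff_mul_symbR_eq_one hA heven hinv hκ
  rw [← h]
  congr 1
  refine sum_congr rfl fun j hj => ?_
  rw [mem_Icc] at hj
  exact cExt_of_mem hj.1 hj.2

/-- **(c)**: the coefficients are even in `κ` (kernels even).
[cite: Buchholz2016, Thm 2.4 (M_k(x) = M_k(−x))] -/
theorem cExt_fourierCoeff_neg {N : ℕ} {𝒞 : ℕ → (Fin d → ZMod M) → ℝ}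
    (heven : ∀ k ∈ Icc 1 (N + 1), ∀ x, 𝒞 k (-x) = 𝒞 k x) (κ : Fin d → ZMod M) (j : ℕ) :
    cExt N (fun j => fourierCoeff (𝒞 j) (-κ)) j = cExt N (fun j => fourierCoeff (𝒞 j) κ) j := by
  unfold cExt
  split_ifs with hj
  · simp only [fourierCoeff_neg_of_even (heven j (mem_Icc.2 hj)) κ]
  · rfl

/-- **(c)**: the coefficients vanish at the zero mode (kernels have zero sum).
[cite: Buchholz2016, Thm 2.4 (i) (zero average)] -/
theorem cExt_fourierCoeff_zero_mode {N : ℕ} {𝒞 : ℕ → (Fin d → ZMod M) → ℝ}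
    (hsum : ∀ k ∈ Icc 1 (N + 1), ∑ x, 𝒞 k x = 0) (j : ℕ) :
    cExt N (fun j => fourierCoeff (𝒞 j) (0 : Fin d → ZMod M)) j = 0 := by
  unfold cExt
  split_ifs with hj
  · exact re_fourierCoeff_zero_of_sum_eq_zero (hsum j (mem_Icc.2 hj))
  · rfl

/-- The tails are even in `κ`. [cite: AdamsBuchholzKoteckyMuller2019, Lemma 7.3 (7.31)] -/
theorem tailMul_neg {N : ℕ} {𝒞 : ℕ → (Fin d → ZMod M) → ℝ}
    (heven : ∀ k ∈ Icc 1 (N + 1), ∀ x, 𝒞 k (-x) = 𝒞 k x) (k : ℕ) (κ : Fin d → ZMod M) :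
    tailMul N (fun κ j => fourierCoeff (𝒞 j) κ) k (-κ) = tailMul N (fun κ j => fourierCoeff (𝒞 j) κ) k κ := by
  unfold tailMul
  exact sum_congr rfl fun j _ => cExt_fourierCoeff_neg heven κ j

/-- The tails vanish at the zero mode. [cite: AdamsBuchholzKoteckyMuller2019, Lemma 7.3 (7.31)] -/
theorem tailMul_zero_mode {N : ℕ} {𝒞 : ℕ → (Fin d → ZMod M) → ℝ}
    (hsum : ∀ k ∈ Icc 1 (N + 1), ∑ x, 𝒞 k x = 0) (k : ℕ) :
    tailMul N (fun κ j => fourierCoeff (𝒞 j) κ) k (0 : Fin d → ZMod M) = 0 := by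
  unfold tailMul
  exact sum_eq_zero fun j _ => cExt_fourierCoeff_zero_mode hsum j

end Literature.MathematicalPhysics.StatisticalMechanics.GradientFRD

end
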